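import Mathlib
import Summits.Ventures.PercRepro2.HCov
import Summits.Ventures.PercRepro2.HCovSwap
import Summits.Ventures.PercRepro2.RECMReduction
import Summits.Ventures.PercRepro2.CCWReduced
import Summits.Ventures.PercRepro2.CutVertexPaths
import Summits.Ventures.PercRepro2.CutOneFar
import Summits.Ventures.PercRepro2.CutPrune
import Summits.Ventures.PercRepro2.CutTwoFarA13Classes
import Summits.Ventures.PercRepro2.PocketSign
import Summits.Ventures.PercRepro2.SepTwoGcZero
import Summits.Ventures.PercRepro2.SepThreeGcZero
import Summits.Ventures.PercRepro2.CycleNecklace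
import Summits.Ventures.PercRepro2.BlockSubstClass
import Summits.Ventures.PercRepro2.SevenClass
import Summits.Ventures.PercRepro2.PendantRootReduction
import Summits.Ventures.PercRepro2.GcSkelRules
import Summits.Ventures.PercRepro2.GcSkelReduction
import Summits.Ventures.PercRepro2.GcSkelReductionS
import Summits.Ventures.PercRepro2.GcSkelReductionC
import Summits.Ventures.PercRepro2.HubClassesAll
import Summits.Ventures.PercRepro2.GcSkelReductionR
import Summits.Ventures.PercRepro2.GcSkelReductionN
import Summits.Ventures.PercRepro2.GcSkelReductionB
import Summits.Ventures.PercRepro2.GcSkelReductionSeven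

/-!
# The residual with no pendant root (blind cell PercRepro2, typer-1 g52)

p5 g24's `LeafRoot.HCov_pendant_root_contract` / `'` (PendantRootReduction.lean): at a pendant root
edge `e = {a₂, y}` (resp. `{a₁, y}`) to an UNMARKED `y`, (HCOV) on the contracted graph
`contractRootEdge ends a₂ y` gives (HCOV) on `G`, at every weight — a REDUCTION lowering
`nonLoopCard` (`nonLoopCard_contract_lt`). So a pendant root leaves the residual altogether: at a
marked vertex it was a theorem (`GcSkelReductionS.lean`), at an unmarked one it now reduces.

**`WReducedP`** := `WReducedSeven` ∧ neither root has non-loop degree one; the only pendant mark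
left in the residual is `a₃` at an unmarked vertex of degree `≥ 3` — S3.10's (G1) (the cut-vertex
form of (LEAF-½)). **`HCov_all_iff_HCovWRedP_all`** — one strong induction on `nonLoopCard` over
all finite edge types carrying every move of the lane and the new one.
-/

namespace Summit.Ventures.PercRepro2

open CovForm Contract RECM CutVertexM9 SepPair

namespace WRed

section ClassP

variable {V : Type*} {E : Type*} [Fintype E] [DecidableEq E] [DecidableEq V]

/-- **The residual with no pendant root**: `WReducedSeven`, and neither root is a leaf. -/
structure WReducedP (ends : E → Sym2 V) (o a₁ a₂ a₃ b : V) : Prop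
    extends WReducedSeven ends o a₁ a₂ a₃ b where
  /-- `a₁` is not a leaf -/
  deg_a1 : nonLoopDeg ends a₁ ≠ 1
  /-- `a₂` is not a leaf -/
  deg_a2 : nonLoopDeg ends a₂ ≠ 1

end ClassP

section Closure

variable (R : Type*) [Field R] [LinearOrder R] [IsStrictOrderedRing R]

/-- **(HCOV) on the residual with no pendant root**. -/
def HCovWRedP_all : Prop :=
  ∀ (V E : Type) [Fintype V] [DecidableEq V] [Fintype E] [DecidableEq E]
    (ends : E → Sym2 V) (p : E → R), IsProbVec p →
    ∀ o a₁ a₂ a₃ b : V, a₁ ≠ a₂ → a₁ ≠ a₃ → a₂ ≠ a₃ → o ≠ a₁ → o ≠ a₂ → o ≠ a₃ → o ≠ b →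
      b ≠ a₁ → b ≠ a₂ → b ≠ a₃ → WReducedP ends o a₁ a₂ a₃ b → HCov p ends o a₁ a₂ a₃ b

end Closure

section Main

variable {R : Type*} [Field R] [LinearOrder R] [IsStrictOrderedRing R]

/-- **The reduction to the residual with no pendant root**, by strong induction on the number of
non-loop edges over all finite edge types: every move of `GcSkelReductionC.lean`, the pendant-root
contraction at an unmarked vertex (p5 g24), and every class theorem of the lane; else the instance
is in `WReducedP`. -/
theorem HCov_of_wredP_of_base (hB : HCovWRedP_all R) (n : ℕ) :
    ∀ (V E : Type) [Fintype V] [DecidableEq V] [Fintype E] [DecidableEq E] (ends : E → Sym2 V),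
      nonLoopCard ends = n → ∀ (p : E → R), IsProbVec p →
      ∀ o a₁ a₂ a₃ b : V, a₁ ≠ a₂ → a₁ ≠ a₃ → a₂ ≠ a₃ → o ≠ a₁ → o ≠ a₂ → o ≠ a₃ → o ≠ b →
        b ≠ a₁ → b ≠ a₂ → b ≠ a₃ → HCov p ends o a₁ a₂ a₃ b := by
  induction n using Nat.strong_induction_on with
  | _ n ih =>
  intro V E _ _ _ _ ends hn p hp o a₁ a₂ a₃ b h12 h13 h23 ho1 ho2 ho3 hob hb1 hb2 hb3
  have ih' : IHBelow R V E n := fun ends' hlt => ih _ hlt V E ends' rfl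
  by_cases hsimp : Simple ends
  swap
  · unfold Simple at hsimp
    push Not at hsimp
    obtain ⟨g₁, g₂, hg12, hnd, hpar⟩ := hsimp
    obtain ⟨u, v, huv⟩ : ∃ u v, ends g₁ = s(u, v) :=
      (Sym2.exists (f := fun t => ends g₁ = t)).1 ⟨ends g₁, rfl⟩
    have hnd2 : ¬ (ends g₂).IsDiag := by rw [← hpar]; exact hnd
    unfold HCov
    rw [Gc_parallel p hg12 hpar.symm u o a₁ a₂ a₃ b]
    exact ih' _ (hn ▸ nonLoopCard_update_loop_lt ends hnd2 u) _ (isProbVec_parallel hp g₁ g₂)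
      o a₁ a₂ a₃ b h12 h13 h23 ho1 ho2 ho3 hob hb1 hb2 hb3
  by_cases hun : ∃ y, Unmarked o a₁ a₂ a₃ b y ∧ (nonLoopDeg ends y = 1 ∨ nonLoopDeg ends y = 2)
  · obtain ⟨y, hy, hd⟩ := hun
    rcases hd with h1 | h2
    · obtain ⟨e, x, he, hxy, hleaf⟩ := leaf_of_nonLoopDeg_one h1
      have hne : ¬ (ends e).IsDiag := by
        rw [he, Sym2.mk_isDiag_iff]
        exact hxy
      unfold HCov
      rw [Gc_leaf_at p he hxy hy hleaf]
      exact ih' _ (hn ▸ nonLoopCard_update_loop_lt ends hne x) p hp o a₁ a₂ a₃ b h12 h13 h23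
        ho1 ho2 ho3 hob hb1 hb2 hb3
    · obtain ⟨e, f, x, w, hef, he, hf, hxy, hyw, hdeg⟩ := series_of_nonLoopDeg_two h2
      unfold HCov
      rw [Gc_series_at p he hf hef hxy hyw hy hdeg]
      exact ih' _ (hn ▸ nonLoopCard_contract_lt ends hxy he) _ (isProbVec_series hp e f)
        o a₁ a₂ a₃ b h12 h13 h23 ho1 ho2 ho3 hob hb1 hb2 hb3
  by_cases hdo : nonLoopDeg ends o = 1
  · exact HCov_of_o_leaf ih' ends hn p hp o a₁ a₂ a₃ b h12 h13 h23 ho1 ho2 ho3 hob hb1 hb2 hb3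
      hdo
  by_cases hdb : nonLoopDeg ends b = 1
  · exact HCov_of_b_leaf ih' ends hn p hp o a₁ a₂ a₃ b h12 h13 h23 ho1 ho2 ho3 hob hb1 hb2 hb3
      hdb
  by_cases h3 : ∃ (e : E) (x : V), ends e = s(x, a₃) ∧ x ≠ a₃ ∧ nonLoopDeg ends a₃ = 1 ∧
      ¬ Unmarked o a₁ a₂ a₃ b x
  · obtain ⟨e, x, he, hx, hd, hm⟩ := h3
    exact HCov_of_a3_leaf_marked ends p hp o a₁ a₂ a₃ b h13 h23 ho3 hb3 hd ⟨e, x, he, hx, hm⟩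
  by_cases h1 : ∃ (e : E) (x : V), ends e = s(x, a₁) ∧ x ≠ a₁ ∧ nonLoopDeg ends a₁ = 1 ∧
      ¬ Unmarked o a₁ a₂ a₃ b x
  · obtain ⟨e, x, he, hx, hd, hm⟩ := h1
    exact HCov_of_a1_leaf_marked ends p hp o a₁ a₂ a₃ b h12 h13 ho1 hb1 hd ⟨e, x, he, hx, hm⟩
  by_cases h2 : ∃ (e : E) (x : V), ends e = s(x, a₂) ∧ x ≠ a₂ ∧ nonLoopDeg ends a₂ = 1 ∧
      ¬ Unmarked o a₁ a₂ a₃ b x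
  · obtain ⟨e, x, he, hx, hd, hm⟩ := h2
    exact HCov_of_a2_leaf_marked ends p hp o a₁ a₂ a₃ b h12 h23 ho2 hb2 hd ⟨e, x, he, hx, hm⟩
  push Not at h1 h2
  -- a pendant `a₁` at an unmarked vertex: contract it (p5 g24)
  by_cases hd1 : nonLoopDeg ends a₁ = 1
  · obtain ⟨ends₁, e, x, h₁e, hx1, hleaf₁, hagree, hagree', he, -⟩ := exists_relocated hd1
    have hx : Unmarked o a₁ a₂ a₃ b x := h1 e x he hx1 hd1
    have hGc : Gc p ends o a₁ a₂ a₃ b = Gc p ends₁ o a₁ a₂ a₃ b :=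
      Gc_eq_of_agree_nonLoop p hagree hagree' o a₁ a₂ a₃ b
    have hcard : nonLoopCard ends₁ ≤ n := hn ▸ nonLoopCard_le_of_agree hagree'
    have hf₁ : ends₁ e = s(a₁, x) := by rw [h₁e, Sym2.eq_swap]
    unfold HCov
    rw [hGc]
    refine LeafRoot.HCov_pendant_root_contract' p hp hf₁ hleaf₁ hx ho1 h12.symm h13.symm hb1 ?_
    exact ih _ (lt_of_lt_of_le (nonLoopCard_contract_lt ends₁ hx1.symm hf₁) hcard) V E _ rfl p hp
      o a₁ a₂ a₃ b h12 h13 h23 ho1 ho2 ho3 hob hb1 hb2 hb3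
  -- a pendant `a₂` at an unmarked vertex: contract it (p5 g24)
  by_cases hd2 : nonLoopDeg ends a₂ = 1
  · obtain ⟨ends₁, e, x, h₁e, hx2, hleaf₁, hagree, hagree', he, -⟩ := exists_relocated hd2
    have hx : Unmarked o a₁ a₂ a₃ b x := h2 e x he hx2 hd2
    have hGc : Gc p ends o a₁ a₂ a₃ b = Gc p ends₁ o a₁ a₂ a₃ b :=
      Gc_eq_of_agree_nonLoop p hagree hagree' o a₁ a₂ a₃ b
    have hcard : nonLoopCard ends₁ ≤ n := hn ▸ nonLoopCard_le_of_agree hagree'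
    have hf₁ : ends₁ e = s(a₂, x) := by rw [h₁e, Sym2.eq_swap]
    unfold HCov
    rw [hGc]
    refine LeafRoot.HCov_pendant_root_contract p hp hf₁ hleaf₁ hx ho2 h12 h23.symm hb2 ?_
    exact ih _ (lt_of_lt_of_le (nonLoopCard_contract_lt ends₁ hx2.symm hf₁) hcard) V E _ rfl p hp
      o a₁ a₂ a₃ b h12 h13 h23 ho1 ho2 ho3 hob hb1 hb2 hb3
  -- the cut-vertex moves
  by_cases hP : ∃ (side : E → Bool) (L : Set V) (v : V) (Rt : Set V) (g : E),
      CutVertex ends side L v Rt ∧ (∀ m ∈ ({o, a₁, a₂, a₃, b} : Set V), m ∈ Rt ∨ m = v) ∧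
      side g = true ∧ ¬ (ends g).IsDiag
  · obtain ⟨side, L, v, Rt, g, h, hM, hg, hgd⟩ := hP
    exact CutPrune.HCov_of_right h p o a₁ a₂ a₃ b hM
      (ih _ (hn ▸ nonLoopCard_prune_lt hg hgd) V _ (CutPrune.rends ends side) rfl _
        (CutPrune.isProbVec_rweights hp) o a₁ a₂ a₃ b h12 h13 h23 ho1 ho2 ho3 hob hb1 hb2 hb3)
  by_cases hO : ∃ (side : E → Bool) (L : Set V) (v : V) (Rt : Set V) (w : V),
      CutVertex ends side L v Rt ∧ w ∈ L ∧
      (∀ m ∈ ({o, a₁, a₂, a₃, b} : Set V), m = w ∨ m ∈ Rt ∨ m = v) ∧ 1 < leftCard ends side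
  · obtain ⟨side, L, v, Rt, w, h, hw, hM, hlt⟩ := hO
    obtain ⟨g₁, hg₁, g₂, hg₂, hne⟩ := Finset.one_lt_card.1 hlt
    rw [Finset.mem_filter] at hg₁ hg₂
    exact CutOneFar.HCov_of_reduced h hw p o a₁ a₂ a₃ b hM
      (ih _ (hn ▸ nonLoopCard_oneFar_lt v w hne hg₁.2.1 hg₁.2.2 hg₂.2.1 hg₂.2.2) V _
        (CutOneFar.rends ends side v w) rfl _
        (CutOneFar.isProbVec_rweights_leftProb ends side v w hp) o a₁ a₂ a₃ b h12 h13 h23 ho1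
        ho2 ho3 hob hb1 hb2 hb3)
  by_cases hT : ∃ (side : E → Bool) (L : Set V) (v : V) (Rt : Set V),
      CutVertex ends side L v Rt ∧ TwoThree L v Rt o a₁ a₂ a₃ b
  · obtain ⟨side, L, v, Rt, h, htt⟩ := hT
    exact CutTwoFar.HCov_cut_twoLeft h hp htt
  -- the class theorems
  by_cases hR : RootsToMarks ends o a₁ a₂ a₃ b
  · exact HubAll.HCovR_all_holds V E ends p hp o a₁ a₂ a₃ b h12 h13 h23 ho1 ho2 ho3 hob hb1 hb2
      hb3 hR
  by_cases hR3 : A3RECM.A3ToMarks ends o a₁ a₂ a₃ b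
  · exact HubAll.HCovR3_all_holds V E ends p hp o a₁ a₂ a₃ b h12 h13 h23 ho1 ho2 ho3 hob hb1 hb2
      hb3 hR3
  by_cases hPk : ∃ P : Finset V, PocketConn.IsPocket ends (↑P : Set V) a₁ a₂ ∧ a₃ ∈ P ∧ a₁ ∉ P ∧
      a₂ ∉ P ∧ o ∉ P ∧ b ∉ P
  · obtain ⟨P, hPk, h3', h1', h2', ho', hb'⟩ := hPk
    exact PocketConn.HCov_pocket p hp hPk h12 h1' h2' ho' hb' h3'
  by_cases hs2 : b ∈ cluster ends (sepConfig ends {a₁, a₂}) o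
  swap
  · unfold HCov
    rw [SepTwoGcZero.Gc_eq_zero_of_sepPair hp ends a₃ b (by simp [ho1, ho2]) hs2]
  by_cases hs3 : a₂ ∉ cluster ends (sepConfig ends {a₁, a₃}) o ∪ {a₁, a₃} ∧
      b ∉ cluster ends (sepConfig ends {a₁, a₃}) o
  · unfold HCov
    rw [SepThreeGcZero.Gc_eq_zero_of_sepThree hp ends (by simp [ho1, ho3]) hs3.1 hs3.2]
  by_cases hs3' : a₁ ∉ cluster ends (sepConfig ends {a₂, a₃}) o ∪ {a₂, a₃} ∧
      b ∉ cluster ends (sepConfig ends {a₂, a₃}) o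
  · unfold HCov
    rw [SepThreeGcZero.Gc_eq_zero_of_sepThree' hp ends (by simp [ho2, ho3]) hs3'.1 hs3'.2]
  by_cases hN : ∃ (q : Fin 5 → V) (blk : E → Fin 5) (Vj : Fin 5 → Set V),
      Cycle.IsNecklace ends q blk Vj ∧ ∃ ko k₁ k₂ k₃ kb : Fin 5, ko ≠ k₁ ∧ ko ≠ k₂ ∧ ko ≠ k₃ ∧
      ko ≠ kb ∧ k₁ ≠ k₂ ∧ k₁ ≠ k₃ ∧ k₁ ≠ kb ∧ k₂ ≠ k₃ ∧ k₂ ≠ kb ∧ k₃ ≠ kb ∧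
      q ko = o ∧ q k₁ = a₁ ∧ q k₂ = a₂ ∧ q k₃ = a₃ ∧ q kb = b
  · obtain ⟨q, blk, Vj, hNk, ko, k₁, k₂, k₃, kb, h01, h02, h03, h04, h12', h13', h14, h23', h24,
      h34, rfl, rfl, rfl, rfl, rfl⟩ := hN
    exact Cycle.HCov_necklace hNk p hp ko k₁ k₂ k₃ kb h01 h02 h03 h04 h12' h13' h14 h23' h24 h34
  by_cases h5 : BlockSubst.FiveTerminalClass ends o a₁ a₂ a₃ b
  · exact BlockSubst.HCov_of_fiveTerminalClass ends o a₁ a₂ a₃ b h5 p hp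
  by_cases h6 : BlockSubst.SixTerminalClass ends o a₁ a₂ a₃ b
  · exact BlockSubst.HCov_of_sixTerminalClass ends o a₁ a₂ a₃ b h6 p hp
  by_cases h7 : Seven.SevenSkelClass ends o a₁ a₂ a₃ b
  · exact Seven.HCov_of_sevenSkelClass ends o a₁ a₂ a₃ b h7 p hp
  by_cases h7' : Seven.SevenSkelClass ends o a₂ a₁ a₃ b
  · exact Seven.HCov_of_sevenSkelClass' ends o a₁ a₂ a₃ b h7' p hp
  -- the residual with no pendant root
  push Not at hun h3 hP hO hT hPk hs3 hs3' hN
  exact hB V E ends p hp o a₁ a₂ a₃ b h12 h13 h23 ho1 ho2 ho3 hob hb1 hb2 hb3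
    ⟨⟨⟨⟨⟨⟨⟨⟨hsimp, hun, hdo, hdb⟩, h3, h1, h2⟩, hP, hO, hT⟩, hR, hR3, hPk, hs2, hs3, hs3'⟩, hN⟩,
      h5, h6⟩, h7, h7'⟩, hd1, hd2⟩

/-- **THE WEIGHTED RESIDUAL WITH NO PENDANT ROOT**: (HCOV) for every finite weighted graph with
five distinct marks follows from (HCOV) on `WReducedP` — where the only pendant mark is `a₃`, at
an unmarked vertex of degree `≥ 3`. -/
theorem HCov_all_of_HCovWRedP_all (hB : HCovWRedP_all R) : HCov_all R := by
  intro V E _ _ _ _ ends p hp o a₁ a₂ a₃ b h12 h13 h23 ho1 ho2 ho3 hob hb1 hb2 hb3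
  exact HCov_of_wredP_of_base hB _ V E ends rfl p hp o a₁ a₂ a₃ b h12 h13 h23 ho1 ho2 ho3 hob hb1
    hb2 hb3

/-- The residual with no pendant root is a faithful reduction: `HCov_all ↔ HCovWRedP_all`. -/
theorem HCov_all_iff_HCovWRedP_all : HCov_all R ↔ HCovWRedP_all R :=
  ⟨fun h V E _ _ _ _ ends p hp o a₁ a₂ a₃ b h12 h13 h23 ho1 ho2 ho3 hob hb1 hb2 hb3 _ =>
    h V E ends p hp o a₁ a₂ a₃ b h12 h13 h23 ho1 ho2 ho3 hob hb1 hb2 hb3,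
   HCov_all_of_HCovWRedP_all⟩

end Main

end WRed

end Summit.Ventures.PercRepro2
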